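import Summits.QuantumAdvantage.QuantumAdvantage.Theorems.LengthDialE

/-!
# LengthDial, part F/7 (§11–§12: PADDING (`winCount_pad`, `pairBound_of_hardR`) with the three-charge parity in the form used; the SPLIT a lossless law would give (`LosslessLaw`, rung `losslessLaw_zero`, `Seeds`, `seeds_of_quasiLossOff`, `quasiLoss_of_lawPiece_seeds`)) — support for item stmt-QuantumAdvantage-28401 (`Theses.AbsorptionDial.MassHiQuasi`)

Cell decomp-qadv, seat lens-5 («finite range + asymptotic regime + bridge»), generation 26 — land port of the node
«LengthDial» (published under the cell's HOME/decomp-qadv-lens-5/g26/LengthDial.lean, record NODE-g26.md; RESIDUAL MODE on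
AbsorptionDial:28401 `MassHiQuasi`).  The node file with ONLY the namespace renamed `Theses.LengthDial → Theorems.LengthDial`
and split at section boundaries into parts A–G (each importing the previous; part G alone imports the route file
Theses.AbsorptionDial for the BY-NAME equivalences and `closes`).  Prop-defs = the node's hardness predicates / grades only.
Tree facts reused by name, not restated: `RigidityLaws.walkExp_zero/self`, `RigidityLaws.ringWinU_congr_mod`,
`RigidityLaws.threeCharge`, `RigidityLaws.hasDegF_xor`, `FibreDial.const_of_hasDegF_zero`, `WalkCoreBasics.ringWinU_compl`, `chargeRecursion`, `sliceAt_mem_lowDeg`,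
`Smolensky.comp_mem_lowDeg_of_coord`.  No `sorry`, no new axioms, no instances, no notation.
-/

set_option autoImplicit false
set_option linter.unusedVariables false
set_option linter.dupNamespace false
set_option linter.style.longLine false

namespace Summit.QuantumAdvantage.QuantumAdvantage.Theorems.LengthDial

open Finset
open Summit.QuantumAdvantage.AdviceFreeQNC0
open Literature.Computability.MetaComplexity Literature.Computability.MetaComplexity.Smolensky

/-! ## §11 The other direction of the length axis: PADDING (a length-`k` strategy played at length `k+1`; easiness on a
charge PAIR lifts one length up at the SAME degree: `pairBound_of_hardR`), with the three-charge parity in the form used -/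

section Pair
variable {n k : ℕ}

/-- **THREE-CHARGE PARITY** (0 or 2 of the three charges win at every input), Boolean form — immediate from the
tree's LANDED three-charge identity `RigidityLaws.threeCharge` (`Coset21.threeCharge_holds`: `W_c ⊕ W_{c+1} = W_{c+2}`);
recorded here in the symmetric form the padding argument uses. -/
theorem ringWinU_three (c : ℕ) (y : Fin (n + 1) → (Fin n → Bool) → Bool) (u : Fin n → Bool) :
    xor (xor (ringWinU c y u) (ringWinU (c + 1) y u)) (ringWinU (c + 2) y u) = false := by
  have h := RigidityLaws.threeCharge c y u
  revert h
  cases ringWinU c y u <;> cases ringWinU (c + 1) y u <;> cases ringWinU (c + 2) y u <;> decide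

/-- no input is won at all three charges. -/
theorem not_won_thrice (c : ℕ) (y : Fin (n + 1) → (Fin n → Bool) → Bool) (u : Fin n → Bool) :
    ¬ (ringWinU c y u = true ∧ ringWinU (c + 1) y u = true ∧ ringWinU (c + 2) y u = true) := by
  have h := ringWinU_three c y u
  intro ⟨h0, h1, h2⟩
  rw [h0, h1, h2] at h
  exact Bool.noConfusion h

/-- a win at charge `c` comes with a win at exactly one of the other two charges. -/
theorem won_twice_of_won (c : ℕ) (y : Fin (n + 1) → (Fin n → Bool) → Bool) (u : Fin n → Bool)
    (h0 : ringWinU c y u = true) : xor (ringWinU (c + 1) y u) (ringWinU (c + 2) y u) = true := by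
  have h := ringWinU_three c y u
  rw [h0] at h
  generalize ringWinU (c + 1) y u = a at h ⊢
  generalize ringWinU (c + 2) y u = b at h ⊢
  revert a b h; decide

/-- **charge-averaged value `≤ 2/3`** for EVERY strategy (any complexity):
`#win(c) + #win(c+1) + #win(c+2) ≤ 2 · 2ⁿ`. -/
theorem winCount_three_le (c : ℕ) (y : Fin (n + 1) → (Fin n → Bool) → Bool) :
    winCount n c y + winCount n (c + 1) y + winCount n (c + 2) y ≤ 2 * 2 ^ n := by
  unfold winCount
  rw [Finset.card_filter, Finset.card_filter, Finset.card_filter, ← Finset.sum_add_distrib,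
    ← Finset.sum_add_distrib]
  calc ∑ u : Fin n → Bool, ((if ringWinU c y u = true then 1 else 0) + (if ringWinU (c + 1) y u = true then 1 else 0)
          + (if ringWinU (c + 2) y u = true then 1 else 0))
      ≤ ∑ u : Fin n → Bool, 2 := Finset.sum_le_sum fun u _ => by
          have h := ringWinU_three c y u
          generalize ringWinU c y u = a at h ⊢
          generalize ringWinU (c + 1) y u = b at h ⊢
          generalize ringWinU (c + 2) y u = d at h ⊢
          revert a b d h; decide
    _ = 2 * 2 ^ n := by rw [Finset.sum_const, Finset.card_univ, Fintype.card_fun, Fintype.card_bool,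
          Fintype.card_fin, smul_eq_mul, mul_comm]

/-! ### Padding: a length-`k` strategy played at length `k+1` (cut `0` silent, bit `0` ignored) -/

/-- the padded strategy. -/
def padStrat (y : Fin (k + 1) → (Fin k → Bool) → Bool) : Fin (k + 2) → (Fin (k + 1) → Bool) → Bool :=
  Fin.cons (fun _ => false) (fun h u => y h (Fin.tail u))

/-- the padded strategy on the face `b` plays the original game at charge `c + 1 + 2b`. -/
theorem ringWinU_pad (c : ℕ) (y : Fin (k + 1) → (Fin k → Bool) → Bool) (b : Bool) (u' : Fin k → Bool) :
    ringWinU c (padStrat y) (Fin.cons b u') = ringWinU (c + 1 + 2 * b.toNat) y u' := by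
  rw [chargeRecursion k c (padStrat y) b u']
  have h0 : padStrat y 0 (Fin.cons b u') = false := by
    unfold padStrat
    rw [Fin.cons_zero]
  have h1 : (fun (h : Fin (k + 1)) (v : Fin k → Bool) => padStrat y h.succ (Fin.cons b v)) = y := by
    funext h v
    unfold padStrat
    rw [Fin.cons_succ, Fin.tail_cons]
  rw [h0, h1, Bool.false_and, Bool.false_xor]

/-- **PADDING IDENTITY**: `#win_{k+1}(c, pad y) = #win_k(c+1, y) + #win_k(c, y)`. -/
theorem winCount_pad (c : ℕ) (y : Fin (k + 1) → (Fin k → Bool) → Bool) :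
    winCount (k + 1) c (padStrat y) = winCount k (c + 1) y + winCount k c y := by
  rw [winCount_cons, Fintype.sum_bool]
  have ht : (univ.filter fun u' : Fin k → Bool => ringWinU c (padStrat y) (Fin.cons true u') = true).card
      = winCount k c y := by
    unfold winCount
    have e : ∀ u', ringWinU c (padStrat y) (Fin.cons true u') = ringWinU c y u' := fun u' => by
      rw [ringWinU_pad, RigidityLaws.ringWinU_congr_mod _ _ (show (c + 1 + 2 * Bool.toNat true) % 3 = c % 3 by
        simp only [Bool.toNat_true]; omega)]
    simp_rw [e]
  have hf : (univ.filter fun u' : Fin k → Bool => ringWinU c (padStrat y) (Fin.cons false u') = true).card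
      = winCount k (c + 1) y := by
    unfold winCount
    have e : ∀ u', ringWinU c (padStrat y) (Fin.cons false u') = ringWinU (c + 1) y u' := fun u' => by
      rw [ringWinU_pad, RigidityLaws.ringWinU_congr_mod _ _ (show (c + 1 + 2 * Bool.toNat false) % 3 = (c + 1) % 3 by
        simp only [Bool.toNat_false])]
    simp_rw [e]
  rw [ht, hf, Nat.add_comm]

variable {p : ℕ} [Fact p.Prime]

/-- dropping the first coordinate is a degree-1 substitution. -/
theorem hasDegF_tail {D : ℕ} {f : (Fin k → Bool) → Bool} (hf : HasDegF p f D) :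
    HasDegF p (fun u : Fin (k + 1) → Bool => f (Fin.tail u)) D := by
  unfold HasDegF at *
  refine Smolensky.comp_mem_lowDeg_of_coord (F := ZMod p) (fun (u : Fin (k + 1) → Bool) => Fin.tail u)
    (fun i => ?_) hf
  have h : (fun u : Fin (k + 1) → Bool => if Fin.tail u i = true then (1 : ZMod p) else 0)
      = mono (ZMod p) ({i.succ} : Finset (Fin (k + 1))) := by
    funext u
    rw [mono_apply]
    simp only [Finset.mem_singleton, forall_eq]
    rfl
  rw [h]
  exact mono_mem_lowDeg (by simp)

/-- padding does not raise the degree. -/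
theorem hasDegF_pad {D : ℕ} {y : Fin (k + 1) → (Fin k → Bool) → Bool} (hy : ∀ g, HasDegF p (y g) D)
    (g : Fin (k + 2)) : HasDegF p (padStrat y g) D := by
  refine Fin.cases ?_ (fun h => ?_) g
  · unfold padStrat
    rw [Fin.cons_zero]
    exact hasDegF_falseFn D
  · unfold padStrat
    rw [Fin.cons_succ]
    exact hasDegF_tail (hy h)

/-- **LIFT (easiness persists upward, same degree)**: hardness `θ` at length `k+1` forces, at length `k`
and the SAME degree, that no single strategy wins more than `2θ` summed over two consecutive charges. -/
theorem pairBound_of_hardR {D : ℕ} {θ : ℝ} (h : HardR p (k + 1) D θ)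
    (y : Fin (k + 1) → (Fin k → Bool) → Bool) (hy : ∀ g, HasDegF p (y g) D) (c : ℕ) :
    (winCount k c y : ℝ) + winCount k (c + 1) y ≤ 2 * θ * 2 ^ k := by
  have h1 := h c (padStrat y) (hasDegF_pad hy)
  rw [winCount_pad, Nat.cast_add, pow_succ] at h1
  linarith [h1]

end Pair


/-! ## §12 The split a LOSSLESS law would give: i.o. SEEDS + LAW ⟹ Q (pieces UNDECIDED-with-test ∧ WEAKER) -/

section Split
variable (p : ℕ) [Fact p.Prime]

/-- **LOSSLESS LENGTH LAW at the prime `p`** (UNDECIDED): off-diagonal hardness at lengths `k+1, k` against cut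
degree `D` gives hardness at length `k+2`, ALL charges, against the SAME degree `D` and the same value bound —
the proved law `lengthLaw` without its degree factor `5`.  PROVED at `D = 0` (`losslessLaw_zero`); exhaustively
VERIFIED at `D = 1`, `p ≥ 5` (cut functions = literals and constants) for `k + 2 ≤ 7` (memo N8: optimal values
`1, 1, 15/16, 28/32, 53/64, 102/128` off-diagonal and `1, 1, 14/16, 27/32, 52/64, 97/128` diagonal at lengths `2..7` —
monotone, so the law holds with room); the refuter's test is `D = 2`, `p = 5`, `k ≤ 4` by exact optimisation.
Why it might fail: the absorption MECHANISM needs one XOR per peel (degree `·5`), so for `D ≥ 1` the law can only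
hold for value reasons, not by the node's surgery. -/
def LosslessLaw : Prop :=
  ∀ (k D : ℕ) (θ : ℝ), OffHardR p (k + 1) D θ → OffHardR p k D θ → HardR p (k + 2) D θ

variable {p}

/-- RUNG (decided): the lossless law HOLDS at degree `0` — `lengthLaw'` loses its factor only through `5 · 0 = 0`. -/
theorem losslessLaw_zero (k : ℕ) (θ : ℝ) (h1 : OffHardR p (k + 1) 0 θ) (h0 : OffHardR p k 0 θ) :
    HardR p (k + 2) 0 θ := by
  have h1' : OffHardR p (k + 1) (5 * 0) θ := by simpa using h1
  have h0' : OffHardR p k (5 * 0) θ := by simpa using h0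
  exact lengthLaw' h1' h0'

/-- under the lossless law ONE consecutive off-diagonal hard pair bounds EVERY later length (same degree, same
value bound) — the induction of `CutClass.twoLengths` with the class closure replaced by the law. -/
theorem allLengths_of_pair (hL : LosslessLaw p) {m D : ℕ} {θ : ℝ} (hm : OffHardR p m D θ)
    (hm1 : OffHardR p (m + 1) D θ) : ∀ n, m + 2 ≤ n → HardR p n D θ := by
  have inv : ∀ t : ℕ, OffHardR p (m + t) D θ ∧ OffHardR p (m + t + 1) D θ := by
    intro t
    induction t with
    | zero => exact ⟨hm, hm1⟩
    | succ t ih =>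
      obtain ⟨ha, hb⟩ := ih
      refine ⟨by simpa [Nat.add_assoc] using hb, ?_⟩
      have hc : HardR p (m + t + 2) D θ := hL (m + t) D θ hb ha
      have : OffHardR p (m + t + 2) D θ := offHardR_of_hardR hc
      simpa [Nat.add_assoc] using this
  intro n hn
  obtain ⟨t, rfl⟩ : ∃ t, n = m + t + 2 := ⟨n - m - 2, by omega⟩
  obtain ⟨ha, hb⟩ := inv t
  exact hL (m + t) D θ hb ha

/-- THE LAW PIECE (every prime `p ≥ 5`). -/
def LawPiece : Prop := ∀ (p : ℕ) [Fact p.Prime], 5 ≤ p → LosslessLaw p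

/-- **SEEDS** — the infinitely-often form of Q_off: for every degree exponent `C`, below every large length `n`
there is SOME consecutive pair of lengths `m, m+1 ≤ n−1` whose off-diagonal games are hard against cut degree
`(log₂ n)^C` with the quasi-polynomial loss of scale `n`.  Q_off asks this at EVERY pair (`m = n − 2`), `Seeds` at
one pair per scale: the i.o. / a.e. gap is exactly what the lossless law would close. -/
def Seeds : Prop :=
  ∀ (p : ℕ) [Fact p.Prime], 5 ≤ p → ∃ A : ℕ, ∀ C : ℕ, ∃ n₀ : ℕ, ∀ n ≥ n₀, ∃ m : ℕ, m + 2 ≤ n ∧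
    OffHardR p m ((Nat.log 2 n) ^ C) (1 - 1 / (2 : ℝ) ^ ((Nat.log 2 n) ^ A)) ∧
    OffHardR p (m + 1) ((Nat.log 2 n) ^ C) (1 - 1 / (2 : ℝ) ^ ((Nat.log 2 n) ^ A))

/-- Q_off ⟹ Seeds (the dense pair `m = n − 2`; one extra exponent pays for `log₂ (n−2) ≥ log₂ n − 1`). -/
theorem seeds_of_quasiLossOff (h : QuasiLossOff) : Seeds := by
  intro p _ hp
  obtain ⟨A, hA⟩ := h p hp
  refine ⟨A, fun C => ?_⟩
  obtain ⟨n₀, hn₀⟩ := hA (2 * C + 3)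
  refine ⟨n₀ + 6, fun n hn => ?_⟩
  obtain ⟨k, rfl⟩ : ∃ k, n = k + 2 := ⟨n - 2, by omega⟩
  have hk4 : 4 ≤ k := by omega
  have hdeg : Nat.log 2 (k + 2) ^ C ≤ Nat.log 2 k ^ (2 * C + 3) :=
    (Nat.le_mul_of_pos_left _ (by norm_num)).trans (log_ineq C k hk4)
  have hdeg1 : Nat.log 2 (k + 2) ^ C ≤ Nat.log 2 (k + 1) ^ (2 * C + 3) :=
    hdeg.trans (Nat.pow_le_pow_left (Nat.log_mono_right (by omega)) _)
  refine ⟨k, le_rfl, ?_, ?_⟩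
  · intro c' hc' y' hy'
    have h1 := hn₀ k (by omega) c' hc' y' fun g => hasDegF_mono (hy' g) hdeg
    have hθ : (1 : ℝ) - 1 / (2 : ℝ) ^ (Nat.log 2 k ^ A) ≤ 1 - 1 / (2 : ℝ) ^ (Nat.log 2 (k + 2) ^ A) :=
      theta_quasi_mono A (Nat.log_mono_right (show k ≤ k + 2 by omega))
    have := h1.trans (mul_le_mul_of_nonneg_right hθ (by positivity))
    simpa [winCount] using this
  · intro c' hc' y' hy'
    have h1 := hn₀ (k + 1) (by omega) c' hc' y' fun g => hasDegF_mono (hy' g) hdeg1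
    have hθ : (1 : ℝ) - 1 / (2 : ℝ) ^ (Nat.log 2 (k + 1) ^ A) ≤ 1 - 1 / (2 : ℝ) ^ (Nat.log 2 (k + 2) ^ A) :=
      theta_quasi_mono A (Nat.log_mono_right (show k + 1 ≤ k + 2 by omega))
    have := h1.trans (mul_le_mul_of_nonneg_right hθ (by positivity))
    simpa [winCount] using this

/-- **LAW ∧ SEEDS ⟹ Q**. -/
theorem quasiLoss_of_lawPiece_seeds (hL : LawPiece) (hS : Seeds) : QuasiLoss := by
  intro p _ hp
  obtain ⟨A, hA⟩ := hS p hp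
  refine ⟨A, fun C => ?_⟩
  obtain ⟨n₀, hn₀⟩ := hA C
  refine ⟨n₀, fun n hn c y hy => ?_⟩
  obtain ⟨m, hmn, hm, hm1⟩ := hn₀ n hn
  have := allLengths_of_pair (hL p hp) hm hm1 n hmn c y hy
  simpa [winCount] using this

/-- THE SEED PIECE for the residual: the quarter floor gives seeds.  WEAKER than 28401 (kernel:
`seedPiece_of_massHiQuasi`); the converse is the open a.e.-from-i.o. step (must-fail in the probes). -/
def SeedPiece : Prop := QuarterFloor → Seeds

end Split

end Summit.QuantumAdvantage.QuantumAdvantage.Theorems.LengthDial
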